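import Mathlib

/-!
# Tier 3, T3.2 — R-B (FINDING 2, §A15 (i) / ADDENDUM-3 §A16 (b)–(b′)): killing the torsion part of a character
(seat t3-p3, gen 4; blind re-derivation cell `pub-hodge-repro`; paper: proofs/t3-p3/R2-PINNING-ADDENDUM-3.md §A16)

FINDING 2 needs an anticyclotomic character `ψ′` whose `p`-adic avatar is trivial on the torsion subgroup `Δ` of the
anticyclotomic Galois group `Z⁻ = Δ × Γ⁻`.  Starting from any character `ψ₁` of `Z⁻` one puts
`δ′ := ψ₁|_Δ ∘ pr_Δ` and `ψ′ := ψ₁ δ′⁻¹`.  This file types that step for an abstract splitting `e : G ≃* Δ × Γ`,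
writing the two parts out (no definition is introduced):
`δ′(x) = ψ (e.symm ((e x).1, 1))` and `ψ′(x) = ψ (e.symm (1, (e x).2))`.

* `deltaPart_mul`, `gammaPart_mul` — both parts are characters (multiplicative);
* `deltaPart_mul_gammaPart` — `ψ = δ′ · ψ′`, i.e. `ψ′ = ψ₁ δ′⁻¹` is the `Γ`-part;
* `deltaPart_apply_gamma`, `gammaPart_apply_delta` — `δ′` is trivial on the `Γ`-part, `ψ′` on the `Δ`-part (the avatar
  of `ψ′` is trivial on the torsion);
* `deltaPart_apply_eq_one_of_mem_delta`, `gammaPart_apply_eq_one_of_mem_delta` — **the lead's point of care** (S10008):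
  if `ψ₁` is trivial on a set `I` of elements of the `Δ`-part (the inertia image at a prime of the tame conductor,
  finite hence torsion), so are `δ′` and `ψ′` — the correction never ramifies where `ψ₁` does not, so `ψ′` keeps the
  conductor of `ψ₁` away from `p`;
* `deltaPart_pow_card` — `δ′` has order dividing `#Δ` (finite order when `Δ` is finite);
* `gammaPart_eq_self_of_forall_delta` — a character already trivial on the `Δ`-part is its own `Γ`-part.

HONESTY.  Pure group theory on a given splitting; the existence of the splitting `Z⁻ ≅ Δ × Γ⁻` (structure of finitely
generated profinite abelian groups) and everything about Hecke characters is paper (§A16).  Nothing here says anything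
about the status of the Hodge conjecture for CM abelian varieties, which is NOT proved.
-/

set_option autoImplicit false

namespace Summit.Ventures.HodgeRepro.T3.TorsionKill

variable {G Δ Γ M : Type*} [CommGroup G] [CommGroup Δ] [CommGroup Γ] [CommGroup M]

/-- `(1, 1)` is the identity of the product. -/
theorem one_one_eq_one : ((1 : Δ), (1 : Γ)) = (1 : Δ × Γ) := rfl

/-- The `Δ`-part `x ↦ ψ (e.symm ((e x).1, 1))` is multiplicative. -/
theorem deltaPart_mul (e : G ≃* Δ × Γ) (ψ : G →* M) (x y : G) :
    ψ (e.symm ((e (x * y)).1, 1)) = ψ (e.symm ((e x).1, 1)) * ψ (e.symm ((e y).1, 1)) := by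
  rw [← map_mul, ← map_mul, map_mul e]
  congr 2
  ext <;> simp

/-- The `Γ`-part `x ↦ ψ (e.symm (1, (e x).2))` is multiplicative. -/
theorem gammaPart_mul (e : G ≃* Δ × Γ) (ψ : G →* M) (x y : G) :
    ψ (e.symm (1, (e (x * y)).2)) = ψ (e.symm (1, (e x).2)) * ψ (e.symm (1, (e y).2)) := by
  rw [← map_mul, ← map_mul, map_mul e]
  congr 2
  ext <;> simp

/-- `ψ = δ′ · ψ′`: every character is the product of its `Δ`-part and its `Γ`-part. -/
theorem deltaPart_mul_gammaPart (e : G ≃* Δ × Γ) (ψ : G →* M) (x : G) :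
    ψ (e.symm ((e x).1, 1)) * ψ (e.symm (1, (e x).2)) = ψ x := by
  rw [← map_mul, ← map_mul]
  have h : ((e x).1, (1 : Γ)) * ((1 : Δ), (e x).2) = e x := by
    ext <;> simp
  rw [h, MulEquiv.symm_apply_apply]

/-- `δ′` is trivial on the `Γ`-part. -/
theorem deltaPart_apply_gamma (e : G ≃* Δ × Γ) (ψ : G →* M) (γ : Γ) :
    ψ (e.symm ((e (e.symm (1, γ))).1, 1)) = 1 := by
  rw [MulEquiv.apply_symm_apply]
  have h : (((1 : Δ), γ).1, (1 : Γ)) = (1 : Δ × Γ) := rfl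
  rw [h, map_one, map_one]

/-- `ψ′` is trivial on the `Δ`-part: the avatar of `ψ′ = ψ₁ δ′⁻¹` is trivial on the torsion. -/
theorem gammaPart_apply_delta (e : G ≃* Δ × Γ) (ψ : G →* M) (d : Δ) :
    ψ (e.symm (1, (e (e.symm (d, 1))).2)) = 1 := by
  rw [MulEquiv.apply_symm_apply]
  have h : ((1 : Δ), (d, (1 : Γ)).2) = (1 : Δ × Γ) := rfl
  rw [h, map_one, map_one]

/-- On the `Δ`-part, `δ′` agrees with `ψ`. -/
theorem deltaPart_apply_delta (e : G ≃* Δ × Γ) (ψ : G →* M) (d : Δ) :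
    ψ (e.symm ((e (e.symm (d, 1))).1, 1)) = ψ (e.symm (d, 1)) := by
  rw [MulEquiv.apply_symm_apply]

/-- **The lead's point of care.** If `ψ` is trivial on a set `I` of elements of the `Δ`-part (the inertia image at a
prime of the tame conductor, which is finite hence torsion), then so is the correction `δ′`: dividing by `δ′` never
introduces ramification where `ψ` has none. -/
theorem deltaPart_apply_eq_one_of_mem_delta (e : G ≃* Δ × Γ) (ψ : G →* M) (I : Set G)
    (hI : ∀ x ∈ I, (e x).2 = 1) (hψ : ∀ x ∈ I, ψ x = 1) {x : G} (hx : x ∈ I) :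
    ψ (e.symm ((e x).1, 1)) = 1 := by
  have h : ((e x).1, (1 : Γ)) = e x := by
    ext
    · rfl
    · exact (hI x hx).symm
  rw [h, MulEquiv.symm_apply_apply]
  exact hψ x hx

/-- Likewise `ψ′ = ψ δ′⁻¹` is trivial on such a set `I`. -/
theorem gammaPart_apply_eq_one_of_mem_delta (e : G ≃* Δ × Γ) (ψ : G →* M) (I : Set G)
    (hI : ∀ x ∈ I, (e x).2 = 1) {x : G} (hx : x ∈ I) :
    ψ (e.symm (1, (e x).2)) = 1 := by
  rw [hI x hx, one_one_eq_one, map_one, map_one]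

/-- `δ′` has order dividing the order of `Δ`: a finite-order character when `Δ` is finite. -/
theorem deltaPart_pow_card [Finite Δ] (e : G ≃* Δ × Γ) (ψ : G →* M) (x : G) :
    ψ (e.symm ((e x).1, 1)) ^ Nat.card Δ = 1 := by
  rw [← map_pow, ← map_pow, Prod.pow_mk, one_pow, pow_card_eq_one', one_one_eq_one, map_one,
    map_one]

/-- A character already trivial on the `Δ`-part is its own `Γ`-part (`δ′ = 1`). -/
theorem gammaPart_eq_self_of_forall_delta (e : G ≃* Δ × Γ) (ψ : G →* M)
    (h : ∀ d : Δ, ψ (e.symm (d, 1)) = 1) (x : G) : ψ (e.symm (1, (e x).2)) = ψ x := by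
  have := deltaPart_mul_gammaPart e ψ x
  rw [h, one_mul] at this
  exact this

end Summit.Ventures.HodgeRepro.T3.TorsionKill
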